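import Mathlib.LinearAlgebra.BilinearForm.Basic
import Mathlib.Algebra.Order.Field.Basic
import Mathlib.Algebra.Order.BigOperators.Group.Finset
import Mathlib.Algebra.BigOperators.Field
import Mathlib.Algebra.Module.BigOperators
import Mathlib.Tactic.FieldSimp
import Mathlib.Tactic.Ring
import Mathlib.Tactic.Linarith
import Mathlib.Tactic.Positivity
import HarnessLib

/-!
# Mukai vectors in extensions: `(v(F)²)/r(F) + (v(G)²)/r(G) − (v(E)²)/r(E)` (Mukai 1987, Prop. 2.16–2.19) AS PRINTED

`Literature/AlgebraicGeometry/ModuliOfSheaves/MukaiVectorExtensions.lean`, namespace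
`Literature.AlgebraicGeometry.ModuliOfSheaves.Mukai1987Extensions`. Family `hodge`; typed by the literature seat
`lit-w-mukai` of the venture cell `pub-hsemireg` (Mukai AS PRINTED). HONEST FRAMING: linear algebra of a bilinear form
only — the ALGEBRA of the printed statements, with their geometric inputs (additivity of `v` and `r` in an exact sequence,
`ρ(S) = 1`, the Hodge index theorem, positivity of ranks of nontorsion sheaves) taken as HYPOTHESES on vectors of a
`K`-module; no surface, sheaf, slope or filtration is constructed; nothing here bears on the Hodge conjecture. No
definition, no named fact, no `sorry`.

## The printed statements (verbatim, by eye from the author's scan of the Tata volume, printed pp. 359–361)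

[Mukai1987ModuliBundlesK3] S. Mukai, *On the moduli space of bundles on K3 surfaces, I*, Tata Inst. Fund. Res. Stud.
Math. 11 (1987) 341–413; §2 standing hypothesis (p. 350) «we assume that S is an abelian or K3 surface»; `v(E) ∈ H̃(S, ℤ)`
the Mukai vector, `(v²) = (v.v)` for the pairing (1.1) «`(α.β) = −α⁰ ∪ β⁴ + α² ∪ β² − α⁴ ∪ β⁰`» (so `(v²) = (ℓ²) − 2rs` for
`v = (r, ℓ, s)`), `r(E)` the rank, `c₁` the first Chern class.
* p. 359 L-3 – p. 360 L6: «Let `0 → F → E → G → 0` be an exact sequence of nontorsion sheaves on `S`. Since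
  `v(E) = v(F) + v(G)` and `r(E) = r(F) + r(G)`, we have
  `(v(F)²)/r(F) + (v(E)²)/r(G) − (v(E)²)/r(E) = (r(F)r(G)/r(E)) (v(F)/r(F) − v(G)/r(G))²` [sic: the second term is
  `(v(G)²)/r(G)`, as in the Proposition]. Since `v(F)/r(F) − v(G)/r(G) = (0, c₁(F)/r(F) − c₁(G)/r(G), s(F)/r(F) − s(G)/r(G))`,
  the right hand side of the above equality is equal to `(r(F)r(G)/r(E)) (c₁(F)/r(F) − c₁(G)/r(G))²`. Hence we have»
* **PROPOSITION 2.16** (p. 360): «Let `0 → F → E → G → 0` be an exact sequence of nontorsion sheaves. Then we have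
  `(v(F)²)/r(F) + (v(G)²)/r(G) − (v(E)²)/r(E) = (r(F)r(G)/r(E)) (c₁(F)/r(F) − c₁(G)/r(G))²`.» «If `ρ(S) = 1`, then the right
  hand side is always nonnegative because we are assuming that `S` is algebraic. Hence we have»
* **COROLLARY 2.17** (p. 360): «If (`S` is algebraic and) `ρ(S) = 1`, then `(v(F)²)/r(F) + (v(G)²)/r(G) ≧ (v(E)²)/r(E)`. Here
  equality holds if and only if `c₁(F)/r(F) = c₁(G)/r(G)`.»
* p. 360 bottom: «If `F` and `G` have the same slope with respect to an ample line bundle `A`, i.e., `μ_A(F) = μ_A(G)`, then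
  we have `(A. c₁(F)/r(F) − c₁(G)/r(G)) = 0`. Hence, by the Hodge index theorem `(c₁(F)/r(F) − c₁(G)/r(G))²` is always
  nonpositive and is equal to zero if and only if `c₁(F)/r(F) = c₁(G)/r(G)`. Hence we have»
* **COROLLARY 2.18** (p. 361): «Assume that `F` and `G` have the same slope with respect to an ample line bundle. Then we
  have `(v(F)²)/r(F) + (v(G)²)/r(G) ≦ (v(E)²)/r(E)`. and equality holds if and only if `c₁(F)/r(F) = c₁(G)/r(G)`.»
* p. 361: «Let `E` be a μ-semi-stable sheaf. Then there is a filtration `E_* : 0 = E₀ ⊂ E₁ ⊂ … ⊂ E_n = E` such that every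
  successive quotient `F_i = E_i/E_{i−1}` is μ-stable and has the same slope as `E`. Such a filtration `E_*` is called a
  μ-JHS filtration of `E`. Applying the above corollary repeatedly for this filtration, we have the following:»
  **PROPOSITION 2.19** (p. 361): «Let `E` be a μ-semi-stable sheaf and `F_i` (`1 ≦ i ≦ n`) the successive quotients of a
  μ-JHS filtration of `E`. Then we have `Σ_{i=1}^{n} (v(F_i)²)/r(F_i) ≦ (v(E)²)/r(E)`. Equality holds if and only if
  `c₁(F_i)/r(F_i)` is equal to `c₁(E)/r(E)` for every `1 ≦ i ≦ n`.»

## Rendering and what is proved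

`K` a field (a linearly ordered field for the inequalities), `V` a `K`-module carrying a bilinear form `B` (the
intersection form on `NS(S) ⊗ K`, or on `H^{1,1}(S, ℝ)` — NOT on all of `H²(S, ℝ)`, where the Hodge-index hypothesis
below fails), written `B x y`; a «Mukai vector» is a triple `(r, c, s)` with square `B c c − 2·r·s`. For sheaves the
family in `prop_2_19` is the set of JHS factors, COR. 2.18 being applied to `0 → E_{i−1} → E_i → F_i → 0` (all of slope
`μ(E)`); the abstract finite family is a faithful generalisation since `v` and `r` are additive. Using PROP. 2.19 to get
«semistable and isotropic ⇒ every factor isotropic of the same slope» needs IN ADDITION `(v_i²) ≥ 0` for each factor —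
not in this file. PROVED:
* `bilin_extension_identity` — for ANY bilinear `B` and `r_F, r_G, r_F + r_G ≠ 0`:
  `B(f,f)/r_F + B(g,g)/r_G − B(f+g,f+g)/(r_F+r_G) = (r_F r_G/(r_F+r_G))·B(f/r_F − g/r_G, f/r_F − g/r_G)` — the display on
  p. 360 L1–2 (for the full Mukai pairing) and the mechanism of everything below;
* `prop_2_16` — PROPOSITION 2.16 in coordinates (the `s`-parts cancel; `v(E) = v(F) + v(G)`, `r(E) = r(F) + r(G)` are the
  substitution `c_E = c_F + c_G`, `s_E = s_F + s_G`, `r_E = r_F + r_G`);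
* `cor_2_17`, `cor_2_17_eq_iff` — COROLLARY 2.17 with «`ρ(S) = 1`» rendered as `c_F = t_F·h`, `c_G = t_G·h`, `B h h > 0`,
  and ranks `r_F, r_G > 0` («nontorsion»);
* `cor_2_18`, `cor_2_18_eq_iff` — COROLLARY 2.18 with the Hodge index theorem AS HYPOTHESIS (`B x x ≤ 0` whenever
  `B a x = 0`, resp. its definite form `B a x = 0 ∧ B x x = 0 → x = 0` on numerical classes) and «same slope» as
  `B a c_F / r_F = B a c_G / r_G`;
* `prop_2_19` — PROPOSITION 2.19's inequality for a finite family `(r_i, c_i, s_i)` of common slope `μ` («applying the above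
  corollary repeatedly»: induction on the family); `prop_2_19_eq_of_forall` and `prop_2_19_eq_iff` — its equality clause
  (definite Hodge index AS HYPOTHESIS; induction with COR. 2.18's equality clause at each step).
NOT here: sheaves, `μ`-stability, JHS filtrations, the Hodge index theorem itself.

## References
* [Mukai1987ModuliBundlesK3] S. Mukai, On the moduli space of bundles on K3 surfaces. I, Tata Inst. Fund. Res. Stud. Math.
  11 (1987): (1.1) p. 342; p. 359 L-3 – p. 361: PROP. 2.16, COR. 2.17, COR. 2.18, PROP. 2.19 (REM. 2.20 not used).
-/

namespace Literature.AlgebraicGeometry.ModuliOfSheaves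

namespace Mukai1987Extensions

open Finset

section Identity

variable {K : Type*} [Field K] {V : Type*} [AddCommGroup V] [Module K V] (B : LinearMap.BilinForm K V)

/-- **The identity behind PROP. 2.16** (p. 360 L1–2, printed there for the Mukai pairing): for any bilinear form `B`,
`B(f,f)/r_F + B(g,g)/r_G − B(f+g, f+g)/(r_F + r_G) = (r_F r_G/(r_F + r_G)) · B(f/r_F − g/r_G, f/r_F − g/r_G)`
(`r_F, r_G, r_F + r_G ≠ 0`; no symmetry needed). [cite: Mukai1987ModuliBundlesK3, Prop. 2.16 (proof display), p. 360] -/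
theorem bilin_extension_identity (f g : V) {rF rG : K} (hF : rF ≠ 0) (hG : rG ≠ 0) (hE : rF + rG ≠ 0) :
    B f f / rF + B g g / rG - B (f + g) (f + g) / (rF + rG) =
      rF * rG / (rF + rG) * B (rF⁻¹ • f - rG⁻¹ • g) (rF⁻¹ • f - rG⁻¹ • g) := by
  simp only [map_add, map_sub, map_smul, LinearMap.add_apply, LinearMap.sub_apply, LinearMap.smul_apply, smul_eq_mul]
  field_simp
  ring

/-- **PROPOSITION 2.16** (coordinates). For «Mukai vectors» `v_F = (r_F, c_F, s_F)`, `v_G = (r_G, c_G, s_G)` and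
`v_E = v_F + v_G` (so `r_E = r_F + r_G`), with `(v²) = B(c, c) − 2rs` and nonzero ranks:
`(v_F²)/r_F + (v_G²)/r_G − (v_E²)/r_E = (r_F r_G/r_E) · B(c_F/r_F − c_G/r_G, c_F/r_F − c_G/r_G)` — the `s`-parts cancel and
the rank part of `v_F/r_F − v_G/r_G` vanishes. [cite: Mukai1987ModuliBundlesK3, Prop. 2.16, p. 360] -/
theorem prop_2_16 (cF cG : V) (sF sG : K) {rF rG : K} (hF : rF ≠ 0) (hG : rG ≠ 0) (hE : rF + rG ≠ 0) :
    (B cF cF - 2 * rF * sF) / rF + (B cG cG - 2 * rG * sG) / rG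
        - (B (cF + cG) (cF + cG) - 2 * (rF + rG) * (sF + sG)) / (rF + rG) =
      rF * rG / (rF + rG) * B (rF⁻¹ • cF - rG⁻¹ • cG) (rF⁻¹ • cF - rG⁻¹ • cG) := by
  rw [← bilin_extension_identity B cF cG hF hG hE]
  field_simp
  ring

end Identity

section Signs

variable {K : Type*} [Field K] [LinearOrder K] [IsStrictOrderedRing K]
  {V : Type*} [AddCommGroup V] [Module K V] (B : LinearMap.BilinForm K V)

/-- **COROLLARY 2.17** (the sign, «`ρ(S) = 1`»): if `c_F = t_F·h`, `c_G = t_G·h` with `B(h, h) > 0` and the ranks are positive,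
then `(v_F²)/r_F + (v_G²)/r_G ≥ (v_E²)/r_E` (`v_E = v_F + v_G`). [cite: Mukai1987ModuliBundlesK3, Cor. 2.17, p. 360] -/
theorem cor_2_17 (h : V) (hh : 0 < B h h) (tF tG sF sG : K) {rF rG : K} (hF : 0 < rF) (hG : 0 < rG) :
    (B (tF • h + tG • h) (tF • h + tG • h) - 2 * (rF + rG) * (sF + sG)) / (rF + rG) ≤
      (B (tF • h) (tF • h) - 2 * rF * sF) / rF + (B (tG • h) (tG • h) - 2 * rG * sG) / rG := by
  have hE : 0 < rF + rG := add_pos hF hG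
  have key := prop_2_16 B (tF • h) (tG • h) sF sG hF.ne' hG.ne' hE.ne'
  have hsq : B (rF⁻¹ • (tF • h) - rG⁻¹ • (tG • h)) (rF⁻¹ • (tF • h) - rG⁻¹ • (tG • h)) =
      (rF⁻¹ * tF - rG⁻¹ * tG) ^ 2 * B h h := by
    simp only [map_sub, map_smul, LinearMap.sub_apply, LinearMap.smul_apply, smul_eq_mul]
    ring
  have hnn : 0 ≤ rF * rG / (rF + rG) * B (rF⁻¹ • (tF • h) - rG⁻¹ • (tG • h)) (rF⁻¹ • (tF • h) - rG⁻¹ • (tG • h)) := by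
    rw [hsq]; positivity
  linarith

/-- **COROLLARY 2.17, equality clause**: under the same hypotheses, equality holds iff `c_F/r_F = c_G/r_G`, i.e.
`t_F/r_F = t_G/r_G`. [cite: Mukai1987ModuliBundlesK3, Cor. 2.17, p. 360] -/
theorem cor_2_17_eq_iff (h : V) (hh : 0 < B h h) (tF tG sF sG : K) {rF rG : K} (hF : 0 < rF) (hG : 0 < rG) :
    (B (tF • h) (tF • h) - 2 * rF * sF) / rF + (B (tG • h) (tG • h) - 2 * rG * sG) / rG =
        (B (tF • h + tG • h) (tF • h + tG • h) - 2 * (rF + rG) * (sF + sG)) / (rF + rG) ↔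
      tF / rF = tG / rG := by
  have hE : 0 < rF + rG := add_pos hF hG
  have key := prop_2_16 B (tF • h) (tG • h) sF sG hF.ne' hG.ne' hE.ne'
  have hsq : B (rF⁻¹ • (tF • h) - rG⁻¹ • (tG • h)) (rF⁻¹ • (tF • h) - rG⁻¹ • (tG • h)) =
      (rF⁻¹ * tF - rG⁻¹ * tG) ^ 2 * B h h := by
    simp only [map_sub, map_smul, LinearMap.sub_apply, LinearMap.smul_apply, smul_eq_mul]
    ring
  rw [← sub_eq_zero, key, hsq]
  have hc : 0 < rF * rG / (rF + rG) := by positivity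
  constructor
  · intro h0
    have h1 : (rF⁻¹ * tF - rG⁻¹ * tG) ^ 2 * B h h = 0 := by
      rcases mul_eq_zero.mp h0 with h' | h'
      · exact absurd h' hc.ne'
      · exact h'
    have h2 : rF⁻¹ * tF - rG⁻¹ * tG = 0 := by
      rcases mul_eq_zero.mp h1 with h' | h'
      · exact pow_eq_zero_iff (n := 2) (by norm_num) |>.mp h'
      · exact absurd h' hh.ne'
    rw [div_eq_inv_mul, div_eq_inv_mul]
    exact sub_eq_zero.mp h2
  · intro heq
    have : rF⁻¹ * tF - rG⁻¹ * tG = 0 := by rw [← div_eq_inv_mul, ← div_eq_inv_mul, heq, sub_self]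
    rw [this]; ring

/-- **COROLLARY 2.18** (the sign, «same slope», Hodge index AS HYPOTHESIS): if `B x x ≤ 0` for every `x` with
`B a x = 0` (Hodge index for the ample class `a`), the slopes agree, `B a c_F / r_F = B a c_G / r_G`, and the ranks are
positive, then `(v_F²)/r_F + (v_G²)/r_G ≤ (v_E²)/r_E`. [cite: Mukai1987ModuliBundlesK3, Cor. 2.18, p. 361] -/
theorem cor_2_18 (a : V) (hHI : ∀ x : V, B a x = 0 → B x x ≤ 0) (cF cG : V) (sF sG : K) {rF rG : K}
    (hF : 0 < rF) (hG : 0 < rG) (hslope : B a cF / rF = B a cG / rG) :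
    (B cF cF - 2 * rF * sF) / rF + (B cG cG - 2 * rG * sG) / rG ≤
      (B (cF + cG) (cF + cG) - 2 * (rF + rG) * (sF + sG)) / (rF + rG) := by
  have hE : 0 < rF + rG := add_pos hF hG
  have key := prop_2_16 B cF cG sF sG hF.ne' hG.ne' hE.ne'
  have horth : B a (rF⁻¹ • cF - rG⁻¹ • cG) = 0 := by
    simp only [map_sub, map_smul, smul_eq_mul]
    rw [← div_eq_inv_mul, ← div_eq_inv_mul, hslope, sub_self]
  have hnp := hHI _ horth
  have hc : 0 < rF * rG / (rF + rG) := by positivity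
  have : rF * rG / (rF + rG) * B (rF⁻¹ • cF - rG⁻¹ • cG) (rF⁻¹ • cF - rG⁻¹ • cG) ≤ 0 :=
    mul_nonpos_of_nonneg_of_nonpos hc.le hnp
  linarith

/-- **COROLLARY 2.18, equality clause** (definite Hodge index AS HYPOTHESIS on numerical classes: `B a x = 0` and
`B x x = 0` force `x = 0`): under the hypotheses of `cor_2_18`, equality holds iff `c_F/r_F = c_G/r_G`.
[cite: Mukai1987ModuliBundlesK3, Cor. 2.18, p. 361] -/
theorem cor_2_18_eq_iff (a : V) (hHI : ∀ x : V, B a x = 0 → B x x ≤ 0)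
    (hHI' : ∀ x : V, B a x = 0 → B x x = 0 → x = 0) (cF cG : V) (sF sG : K) {rF rG : K}
    (hF : 0 < rF) (hG : 0 < rG) (hslope : B a cF / rF = B a cG / rG) :
    (B cF cF - 2 * rF * sF) / rF + (B cG cG - 2 * rG * sG) / rG =
        (B (cF + cG) (cF + cG) - 2 * (rF + rG) * (sF + sG)) / (rF + rG) ↔
      rF⁻¹ • cF = rG⁻¹ • cG := by
  have hE : 0 < rF + rG := add_pos hF hG
  have key := prop_2_16 B cF cG sF sG hF.ne' hG.ne' hE.ne'
  have horth : B a (rF⁻¹ • cF - rG⁻¹ • cG) = 0 := by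
    simp only [map_sub, map_smul, smul_eq_mul]
    rw [← div_eq_inv_mul, ← div_eq_inv_mul, hslope, sub_self]
  have _hnp := hHI _ horth
  have hc : 0 < rF * rG / (rF + rG) := by positivity
  rw [← sub_eq_zero, key]
  constructor
  · intro h0
    have h1 : B (rF⁻¹ • cF - rG⁻¹ • cG) (rF⁻¹ • cF - rG⁻¹ • cG) = 0 := by
      rcases mul_eq_zero.mp h0 with h' | h'
      · exact absurd h' hc.ne'
      · exact h'
    exact sub_eq_zero.mp (hHI' _ horth h1)
  · intro heq
    rw [heq, sub_self]
    simp

/-- **PROPOSITION 2.19** (the inequality; «applying the above corollary repeatedly»): for a finite family of «factors»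
`(r_i, c_i, s_i)` with positive ranks and common slope `μ` (`B a c_i = μ·r_i`), under Hodge index AS HYPOTHESIS,
`Σ_i (v_i²)/r_i ≤ (v²)/r` for `v = Σ_i v_i`, `r = Σ_i r_i`. [cite: Mukai1987ModuliBundlesK3, Prop. 2.19, p. 361] -/
theorem prop_2_19 {ι : Type*} (s : Finset ι) (a : V) (hHI : ∀ x : V, B a x = 0 → B x x ≤ 0) (μ : K)
    (r : ι → K) (c : ι → V) (sq : ι → K) (hr : ∀ i ∈ s, 0 < r i) (hμ : ∀ i ∈ s, B a (c i) = μ * r i) :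
    ∑ i ∈ s, (B (c i) (c i) - 2 * r i * sq i) / r i ≤
      (B (∑ i ∈ s, c i) (∑ i ∈ s, c i) - 2 * (∑ i ∈ s, r i) * (∑ i ∈ s, sq i)) / (∑ i ∈ s, r i) := by
  classical
  induction s using Finset.induction_on with
  | empty => simp
  | insert j s hj ih =>
    have hrj : 0 < r j := hr j (mem_insert_self j s)
    have hr' : ∀ i ∈ s, 0 < r i := fun i hi => hr i (mem_insert_of_mem hi)
    have hμ' : ∀ i ∈ s, B a (c i) = μ * r i := fun i hi => hμ i (mem_insert_of_mem hi)
    have ih' := ih hr' hμ'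
    rw [sum_insert hj, sum_insert hj, sum_insert hj, sum_insert hj]
    by_cases hs : s = ∅
    · subst hs; simp
    · have hRs : 0 < ∑ i ∈ s, r i := sum_pos hr' (nonempty_iff_ne_empty.mpr hs)
      -- COR 2.18 for the pair (F_j, E_s): slopes agree
      have hslope : B a (c j) / r j = B a (∑ i ∈ s, c i) / ∑ i ∈ s, r i := by
        rw [hμ j (mem_insert_self j s), map_sum]
        rw [Finset.sum_congr rfl (fun i hi => hμ' i hi), ← mul_sum]
        field_simp
      have step := cor_2_18 B a hHI (c j) (∑ i ∈ s, c i) (sq j) (∑ i ∈ s, sq i) hrj hRs hslope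
      linarith

/-- **PROPOSITION 2.19, the «if» of the equality clause**: if every factor has `c_i/r_i = c/r` (a common class `w` with
`c_i = r_i·w`), then `Σ_i (v_i²)/r_i = (v²)/r`. [cite: Mukai1987ModuliBundlesK3, Prop. 2.19, p. 361] -/
theorem prop_2_19_eq_of_forall {K' : Type*} [Field K'] {V' : Type*} [AddCommGroup V'] [Module K' V']
    (B' : LinearMap.BilinForm K' V') {ι : Type*} (s : Finset ι) (w : V') (r : ι → K') (sq : ι → K')
    (hr : ∀ i ∈ s, r i ≠ 0) (hR : ∑ i ∈ s, r i ≠ 0) :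
    ∑ i ∈ s, (B' (r i • w) (r i • w) - 2 * r i * sq i) / r i =
      (B' (∑ i ∈ s, r i • w) (∑ i ∈ s, r i • w) - 2 * (∑ i ∈ s, r i) * (∑ i ∈ s, sq i)) / (∑ i ∈ s, r i) := by
  have hterm : ∀ i ∈ s, (B' (r i • w) (r i • w) - 2 * r i * sq i) / r i = r i * B' w w - 2 * sq i := by
    intro i hi
    rw [div_eq_iff (hr i hi)]
    simp only [map_smul, LinearMap.smul_apply, smul_eq_mul]
    ring
  have hsum : ∑ i ∈ s, r i • w = (∑ i ∈ s, r i) • w := Finset.sum_smul.symm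
  rw [sum_congr rfl hterm, hsum]
  simp only [map_smul, LinearMap.smul_apply, smul_eq_mul]
  rw [eq_div_iff hR, sum_sub_distrib, ← sum_mul, ← mul_sum]
  ring

/-- **PROPOSITION 2.19, equality clause** (definite Hodge index AS HYPOTHESIS): for a nonempty finite family of factors of
common slope and positive ranks, `Σ_i (v_i²)/r_i = (v²)/r` iff `c_i/r_i = c/r` for every `i` («Equality holds if and only
if `c₁(F_i)/r(F_i)` is equal to `c₁(E)/r(E)` for every `1 ≦ i ≦ n`»). [cite: Mukai1987ModuliBundlesK3, Prop. 2.19, p. 361] -/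
theorem prop_2_19_eq_iff {ι : Type*} (s : Finset ι) (hs : s.Nonempty) (a : V) (hHI : ∀ x : V, B a x = 0 → B x x ≤ 0)
    (hHI' : ∀ x : V, B a x = 0 → B x x = 0 → x = 0) (μ : K) (r : ι → K) (c : ι → V) (sq : ι → K)
    (hr : ∀ i ∈ s, 0 < r i) (hμ : ∀ i ∈ s, B a (c i) = μ * r i) :
    ∑ i ∈ s, (B (c i) (c i) - 2 * r i * sq i) / r i =
        (B (∑ i ∈ s, c i) (∑ i ∈ s, c i) - 2 * (∑ i ∈ s, r i) * (∑ i ∈ s, sq i)) / (∑ i ∈ s, r i) ↔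
      ∀ i ∈ s, (r i)⁻¹ • c i = (∑ i ∈ s, r i)⁻¹ • ∑ i ∈ s, c i := by
  classical
  constructor
  swap
  · -- «if»: all `c_i = r_i • w` for the common class `w = c/r`
    intro hall
    have hR : ∑ i ∈ s, r i ≠ 0 := (sum_pos hr hs).ne'
    set w := (∑ i ∈ s, r i)⁻¹ • ∑ i ∈ s, c i with hw
    have hc : ∀ i ∈ s, c i = r i • w := fun i hi => by
      rw [← hall i hi, smul_smul, mul_inv_cancel₀ (hr i hi).ne', one_smul]
    have hsumc : ∑ i ∈ s, c i = ∑ i ∈ s, r i • w := sum_congr rfl hc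
    rw [sum_congr rfl (fun i hi => by rw [hc i hi]), hsumc]
    exact prop_2_19_eq_of_forall B s w r sq (fun i hi => (hr i hi).ne') hR
  · -- «only if»: induction on the family, COR 2.18's equality clause at each step
    induction s using Finset.induction_on with
    | empty => exact absurd hs Finset.not_nonempty_empty
    | insert j s hj ih =>
      intro heq
      have hrj : 0 < r j := hr j (mem_insert_self j s)
      have hr' : ∀ i ∈ s, 0 < r i := fun i hi => hr i (mem_insert_of_mem hi)
      have hμ' : ∀ i ∈ s, B a (c i) = μ * r i := fun i hi => hμ i (mem_insert_of_mem hi)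
      by_cases hs0 : s = ∅
      · subst hs0
        intro i hi
        rw [Finset.insert_empty, mem_singleton] at hi
        subst hi
        simp
      · have hsne : s.Nonempty := nonempty_iff_ne_empty.mpr hs0
        have hRs : 0 < ∑ i ∈ s, r i := sum_pos hr' hsne
        have hE : 0 < r j + ∑ i ∈ s, r i := add_pos hrj hRs
        have hslope : B a (c j) / r j = B a (∑ i ∈ s, c i) / ∑ i ∈ s, r i := by
          rw [hμ j (mem_insert_self j s), map_sum]
          rw [Finset.sum_congr rfl (fun i hi => hμ' i hi), ← mul_sum]
          field_simp
        have h1 := prop_2_19 B s a hHI μ r c sq hr' hμ'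
        have h2 := cor_2_18 B a hHI (c j) (∑ i ∈ s, c i) (sq j) (∑ i ∈ s, sq i) hrj hRs hslope
        rw [sum_insert hj, sum_insert hj, sum_insert hj, sum_insert hj] at heq
        have hA : ∑ i ∈ s, (B (c i) (c i) - 2 * r i * sq i) / r i =
            (B (∑ i ∈ s, c i) (∑ i ∈ s, c i) - 2 * (∑ i ∈ s, r i) * (∑ i ∈ s, sq i)) / (∑ i ∈ s, r i) :=
          le_antisymm h1 (by linarith)
        have hQ : (B (c j) (c j) - 2 * r j * sq j) / r j +
            (B (∑ i ∈ s, c i) (∑ i ∈ s, c i) - 2 * (∑ i ∈ s, r i) * (∑ i ∈ s, sq i)) / (∑ i ∈ s, r i) =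
            (B (c j + ∑ i ∈ s, c i) (c j + ∑ i ∈ s, c i) -
              2 * (r j + ∑ i ∈ s, r i) * (sq j + ∑ i ∈ s, sq i)) / (r j + ∑ i ∈ s, r i) := by
          linarith
        have ihs := ih hsne hr' hμ' hA
        have hjw := (cor_2_18_eq_iff B a hHI hHI' (c j) (∑ i ∈ s, c i) (sq j) (∑ i ∈ s, sq i) hrj hRs hslope).mp hQ
        -- the common value `w = C_s / R_s` is also `(c_j + C_s)/(r_j + R_s)`
        have hw : (r j + ∑ i ∈ s, r i)⁻¹ • (c j + ∑ i ∈ s, c i) = (∑ i ∈ s, r i)⁻¹ • ∑ i ∈ s, c i := by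
          have e1 : c j = r j • ((∑ i ∈ s, r i)⁻¹ • ∑ i ∈ s, c i) := by
            rw [← hjw, smul_smul, mul_inv_cancel₀ hrj.ne', one_smul]
          have e2 : ∑ i ∈ s, c i = (∑ i ∈ s, r i) • ((∑ i ∈ s, r i)⁻¹ • ∑ i ∈ s, c i) := by
            rw [smul_smul, mul_inv_cancel₀ hRs.ne', one_smul]
          calc (r j + ∑ i ∈ s, r i)⁻¹ • (c j + ∑ i ∈ s, c i)
              = (r j + ∑ i ∈ s, r i)⁻¹ • ((r j + ∑ i ∈ s, r i) • ((∑ i ∈ s, r i)⁻¹ • ∑ i ∈ s, c i)) := by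
                rw [add_smul, ← e1, ← e2]
            _ = (∑ i ∈ s, r i)⁻¹ • ∑ i ∈ s, c i := by
                rw [smul_smul, inv_mul_cancel₀ hE.ne', one_smul]
        intro i hi
        rw [sum_insert hj, sum_insert hj, hw]
        rcases mem_insert.mp hi with rfl | hi'
        · exact hjw
        · exact ihs i hi'

end Signs

end Mukai1987Extensions

end Literature.AlgebraicGeometry.ModuliOfSheaves
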